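import Literature.AlgebraicGeometry.AbelianSchemes.AbelianSchemeSymplecticLevel
import Literature.NumberTheory.Adeles.IntegralAdeleResidue
import Literature.AlgebraicGeometry.ModuliOfAbelianVarieties.SiegelAdelicCongrTransport
import Literature.AlgebraicGeometry.ModuliOfAbelianVarieties.SiegelPrincipalLevelMultiplier
import HarnessLib

/-!
# The similitude tower of an element of `K_δ(1) = GSp_δ(ẑ)` and the adelic relabelling of torsion indices

Layer `Literature/AlgebraicGeometry/ModuliOfAbelianVarieties`, namespace
`Literature.AlgebraicGeometry.ModuliOfAbelianVarieties`.  For a polarisation type `δ` (`IsPolarizationType δ`,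
`0 < g`) and `γ ∈ K_δ(1)` — the stabiliser of `ẑ^{2g}` in `GSp_δ(𝔸_f)`, i.e. `GSp_δ(ẑ)` — the reductions
`γ̄_M ∈ GL_{2g}(ℤ/M)` of `γ` (D6 `integralAdeleResidue`, through the level-one reduction homomorphism
`exists_monoidHom_principalLevelSubgroup_one_integralAdeleResidue`) form a tower COMPATIBLE under the projections
`ℤ/kM → ℤ/M`, and each `γ̄_M` is a SIMILITUDE of the type-`δ` symplectic form mod `M` with multiplier `ν_M = ν(γ) mod M`
(the multiplier `ν(γ)` of `γ` is a `ẑ`-unit: `SiegelPrincipalLevelMultiplier`):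
* `typeFormMod_eq_dotProduct`, `typeFormMod_mulVec_mulVec_of_transpose_mul_mul` — the form `E_δ mod M` as a dot
  product and its transformation under `Γᵀ E_δ Γ = ν E_δ`;
* `exists_similitudeTower` — the tower `(γ̄_M, ν_M)_M` with its three properties (entries = residues of the entries
  of `γ`; compatibility of `γ̄` and `ν` along `k·M → M`; similitude);
* `adelicCongr_val_div_of_entries_residue` — for a torsion label `x ∈ (ℤ/M)^{2g}` the rational representatives
  satisfy `γ · (x/M) ≡ (γ̄_M x)/M (mod ẑ^{2g})` (`AdelicCongr γ 1`), the relabelling used when a level structure is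
  twisted by `γ̄` (Milne's `η ↦ η ∘ γ`; the Hecke operator `𝒯(γ)` at full level).
Purpose (cell `hodgecm-mathlib`, rung 0 on `hDel`, (P)-skeleton `M1primeOfFU` stub W4 «integral Hecke operators»):
the number-theoretic half of the twist of a symplectic lift / of a `(J, a)`-marking by `γ ∈ K_δ(1)`.
Theorems only; no `def`, no named fact, no instance.

## References
* J. S. Milne, *Introduction to Shimura Varieties* (2005), §6 Thm. 6.11 and its proof (pp. 74–75), (63) p. 116.
  [Milne2005ShimuraVarieties]
* D. Mumford, J. Fogarty, F. Kirwan, *Geometric Invariant Theory*, 3rd ed. (1994), App. 7A (pp. 235–236).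
  [MumfordFogartyKirwan1994]
* P. Deligne, *Travaux de Shimura*, Sém. Bourbaki 389 (1971), 4.12 (b) p. 149. [Deligne1971TravauxShimura]
* A. Genestier, B. C. Ngô, *Lectures on Shimura varieties* (2006/2020), §1.3. [GenestierNgo2020]
-/

noncomputable section

open CategoryTheory AlgebraicGeometry Matrix NumberField IsDedekindDomain


namespace Literature.AlgebraicGeometry.ModuliOfAbelianVarieties

open Matrix NumberField IsDedekindDomain Literature.NumberTheory.Adeles
open Literature.AlgebraicGeometry.AbelianSchemes

variable {g : ℕ} (δ : Fin g → ℕ)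

/-- `E_δ(x, y) = x · (E_δ y)` with `E_δ` the type-`δ` Gram matrix reduced mod `M`. [cite: GenestierNgo2020, §1.3 (1.3.1)] -/
theorem typeFormMod_eq_dotProduct (M : ℕ) (x y : Fin g ⊕ Fin g → ZMod M) :
    AbelianSchemeOver.typeFormMod δ M x y = x ⬝ᵥ (typeFormOver δ (ZMod M) *ᵥ y) := by
  rw [AbelianSchemeOver.typeFormMod_apply, dotProduct]
  refine Finset.sum_congr rfl fun i _ => ?_
  rw [mulVec, dotProduct, Finset.mul_sum]
  refine Finset.sum_congr rfl fun j _ => ?_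
  rw [typeFormOver_apply, mul_assoc]

/-- A similitude of `E_δ` mod `M` scales the pairing `E_δ(x, y)` by its multiplier:
`E_δ(Γ x, Γ y) = ν · E_δ(x, y)` whenever `ᵗΓ E_δ Γ = ν E_δ`. [cite: Milne2005ShimuraVarieties, §6 p. 67 (definition of GSp)] -/
theorem typeFormMod_mulVec_mulVec_of_transpose_mul_mul {M : ℕ} {Γ : Matrix (Fin g ⊕ Fin g) (Fin g ⊕ Fin g) (ZMod M)}
    {ν : ZMod M} (h : Γᵀ * typeFormOver δ (ZMod M) * Γ = ν • typeFormOver δ (ZMod M))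
    (x y : Fin g ⊕ Fin g → ZMod M) :
    AbelianSchemeOver.typeFormMod δ M (Γ *ᵥ x) (Γ *ᵥ y) = ν * AbelianSchemeOver.typeFormMod δ M x y := by
  rw [typeFormMod_eq_dotProduct, typeFormMod_eq_dotProduct, dotProduct_mulVec, dotProduct_mulVec, dotProduct_mulVec,
    vecMul_vecMul, ← vecMul_transpose, vecMul_vecMul, ← Matrix.mul_assoc, h, vecMul_smul, smul_dotProduct, smul_eq_mul]

/-- **The similitude tower of `γ ∈ K_δ(1) = GSp_δ(ẑ)`**: the reductions `γ̄_M ∈ GL_{2g}(ℤ/M)` of `γ` (★ D6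
`integralAdeleResidue`, `exists_monoidHom_principalLevelSubgroup_one_integralAdeleResidue`) and of its multiplier
`ν(γ) ∈ ẑ^×` (★ `sub_one_mem_levelIdeal_of_isMultiplier_of_isPolarizationType` at `N = 1`) form a tower compatible under
`ℤ/kM → ℤ/M`, and `γ̄_M` is a similitude of `E_δ` mod `M` with multiplier `ν̄_M`.
[cite: Deligne1971TravauxShimura, Exemple 4.16 p. 150 and 4.12 (b) p. 149] [cite: Milne2005ShimuraVarieties, §6 p. 75] -/
theorem exists_similitudeTower (hδ : IsPolarizationType δ) (hg : 0 < g) {γ : gspFinAdelic δ}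
    (hγ : γ ∈ principalLevelSubgroup δ 1) :
    ∃ (Γ : ∀ M : ℕ, GL (Fin g ⊕ Fin g) (ZMod M)) (ν : ∀ M : ℕ, (ZMod M)ˣ),
      (∀ (M : ℕ) [NeZero M] (i j : Fin g ⊕ Fin g)
          (h : ((γ : GL (Fin g ⊕ Fin g) finAdeleQ) : Matrix (Fin g ⊕ Fin g) (Fin g ⊕ Fin g) finAdeleQ) i j ∈
            FiniteAdeleRing.integralAdeles (𝓞 ℚ) ℚ),
          (Γ M : Matrix (Fin g ⊕ Fin g) (Fin g ⊕ Fin g) (ZMod M)) i j = integralAdeleResidue M ⟨_, h⟩) ∧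
      (∀ ⦃M : ℕ⦄ (k : ℕ), M ≠ 0 → k ≠ 0 → ∀ i j,
        ZMod.castHom (Dvd.intro_left k rfl) (ZMod M)
            ((Γ (k * M) : Matrix (Fin g ⊕ Fin g) (Fin g ⊕ Fin g) (ZMod (k * M))) i j) =
          (Γ M : Matrix (Fin g ⊕ Fin g) (Fin g ⊕ Fin g) (ZMod M)) i j) ∧
      (∀ ⦃M : ℕ⦄ (k : ℕ), M ≠ 0 → k ≠ 0 →
        ZMod.castHom (Dvd.intro_left k rfl) (ZMod M) ((ν (k * M) : ZMod (k * M))) = (ν M : ZMod M)) ∧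
      ∀ ⦃M : ℕ⦄, M ≠ 0 → ∀ x y : Fin g ⊕ Fin g → ZMod M,
        AbelianSchemeOver.typeFormMod δ M ((Γ M : Matrix (Fin g ⊕ Fin g) (Fin g ⊕ Fin g) (ZMod M)) *ᵥ x)
            ((Γ M : Matrix (Fin g ⊕ Fin g) (Fin g ⊕ Fin g) (ZMod M)) *ᵥ y) =
          (ν M : ZMod M) * AbelianSchemeOver.typeFormMod δ M x y := by
  classical
  -- integrality of the entries of `γ` and of its multiplier
  have hint : ∀ i j, ((γ : GL (Fin g ⊕ Fin g) finAdeleQ) : Matrix (Fin g ⊕ Fin g) (Fin g ⊕ Fin g) finAdeleQ) i j ∈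
      FiniteAdeleRing.integralAdeles (𝓞 ℚ) ℚ := fun i j =>
    isIntegral_of_isCongOne_one (A := ((γ : GL (Fin g ⊕ Fin g) finAdeleQ) : Matrix (Fin g ⊕ Fin g) (Fin g ⊕ Fin g) finAdeleQ))
      ((mem_principalLevelSubgroup_iff δ).1 hγ).1 i j
  obtain ⟨μ, hμ⟩ := γ.2
  obtain ⟨hμ1, hμ2⟩ := sub_one_mem_levelIdeal_of_isMultiplier_of_isPolarizationType δ hδ hg hγ hμ
  have hone : ∀ {x : finAdeleQ}, x - 1 ∈ levelIdeal 1 → x ∈ FiniteAdeleRing.integralAdeles (𝓞 ℚ) ℚ := by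
    intro x hx
    obtain ⟨y, hy, hyx⟩ := mem_levelIdeal_iff.1 hx
    rw [Nat.cast_one, one_mul] at hyx
    have : x = y + 1 := by rw [hyx]; ring
    rw [this]
    exact add_mem hy (one_mem _)
  set R := FiniteAdeleRing.integralAdeles (𝓞 ℚ) ℚ with hR
  let μint : Rˣ := ⟨⟨μ, hone hμ1⟩, ⟨(μ⁻¹ : finAdeleQˣ), hone hμ2⟩, Subtype.ext (by simp), Subtype.ext (by simp)⟩
  -- the reduction homomorphisms of D6, one per level
  have hred := fun (M : ℕ) (hM : NeZero M) =>
    exists_monoidHom_principalLevelSubgroup_one_integralAdeleResidue M δ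
  choose red hred_apply _ using hred
  let Γ : ∀ M : ℕ, GL (Fin g ⊕ Fin g) (ZMod M) := fun M =>
    if hM : M = 0 then 1 else red M ⟨hM⟩ ⟨γ, hγ⟩
  have hΓM : ∀ (M : ℕ) (hM : M ≠ 0), Γ M = red M ⟨hM⟩ ⟨γ, hγ⟩ := fun M hM => dif_neg hM
  let ν : ∀ M : ℕ, (ZMod M)ˣ := fun M =>
    if hM : M = 0 then 1 else Units.map (@integralAdeleResidue M ⟨hM⟩).toMonoidHom μint
  have hνM : ∀ (M : ℕ) (hM : M ≠ 0),
      (ν M : ZMod M) = @integralAdeleResidue M ⟨hM⟩ (μint : R) := fun M hM => by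
    have h : ν M = Units.map (@integralAdeleResidue M ⟨hM⟩).toMonoidHom μint := dif_neg hM
    rw [h]
    rfl
  have hΓ_apply : ∀ (M : ℕ) (hM : M ≠ 0) (i j : Fin g ⊕ Fin g),
      (Γ M : Matrix (Fin g ⊕ Fin g) (Fin g ⊕ Fin g) (ZMod M)) i j =
        @integralAdeleResidue M ⟨hM⟩ ⟨_, hint i j⟩ := fun M hM i j => by
    rw [hΓM M hM]
    exact hred_apply M ⟨hM⟩ ⟨γ, hγ⟩ i j (hint i j)
  refine ⟨Γ, ν, fun M _ i j h => ?_, fun M k hM0 hk i j => ?_, fun M k hM0 hk => ?_, fun M hM0 x y => ?_⟩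
  · exact hΓ_apply M (NeZero.ne M) i j
  · haveI : NeZero M := ⟨hM0⟩
    haveI : NeZero (k * M) := ⟨Nat.mul_ne_zero hk hM0⟩
    rw [hΓ_apply (k * M) (NeZero.ne (k * M)), hΓ_apply M hM0, ← RingHom.comp_apply,
      castHom_comp_integralAdeleResidue]
  · haveI : NeZero M := ⟨hM0⟩
    haveI : NeZero (k * M) := ⟨Nat.mul_ne_zero hk hM0⟩
    rw [hνM (k * M) (NeZero.ne (k * M)), hνM M hM0, ← RingHom.comp_apply, castHom_comp_integralAdeleResidue]
  · haveI : NeZero M := ⟨hM0⟩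
    -- the similitude identity over `ẑ`, then mod `M`
    let γint : Matrix (Fin g ⊕ Fin g) (Fin g ⊕ Fin g) R := fun i j => ⟨_, hint i j⟩
    have hγint : γint.map R.subtype =
        ((γ : GL (Fin g ⊕ Fin g) finAdeleQ) : Matrix (Fin g ⊕ Fin g) (Fin g ⊕ Fin g) finAdeleQ) := by
      ext i j; rfl
    have hE : (typeFormOver δ R).map R.subtype = typeFormOver δ finAdeleQ := typeFormOver_map δ R.subtype
    have hid : γintᵀ * typeFormOver δ R * γint = (μint : R) • typeFormOver δ R := by
      have key : (γintᵀ * typeFormOver δ R * γint).map R.subtype = ((μint : R) • typeFormOver δ R).map R.subtype := by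
        rw [Matrix.map_mul, Matrix.map_mul, Matrix.transpose_map, hγint, hE]
        have hsm : ((μint : R) • typeFormOver δ R).map R.subtype = (μ : finAdeleQ) • typeFormOver δ finAdeleQ := by
          ext i j
          simp only [map_apply, Matrix.smul_apply, smul_eq_mul, Subring.subtype_apply, Subring.coe_mul, ← hE]
          rfl
        rw [hsm]
        exact hμ
      exact Matrix.map_injective Subtype.val_injective key
    have hidM := congrArg (fun X : Matrix (Fin g ⊕ Fin g) (Fin g ⊕ Fin g) R => X.map (integralAdeleResidue M)) hid
    simp only [Matrix.map_mul, Matrix.transpose_map, typeFormOver_map] at hidM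
    have hsmM : ((μint : R) • typeFormOver δ R).map (integralAdeleResidue M) =
        (integralAdeleResidue M (μint : R)) • typeFormOver δ (ZMod M) := by
      ext i j
      rw [map_apply, Matrix.smul_apply, Matrix.smul_apply, smul_eq_mul, smul_eq_mul, map_mul,
        ← typeFormOver_map δ (integralAdeleResidue M), map_apply]
    rw [hsmM] at hidM
    have hΓ' : (Γ M : Matrix (Fin g ⊕ Fin g) (Fin g ⊕ Fin g) (ZMod M)) = γint.map (integralAdeleResidue M) := by
      ext i j
      rw [hΓ_apply M hM0 i j, map_apply]
    rw [hΓ', hνM M hM0]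
    exact typeFormMod_mulVec_mulVec_of_transpose_mul_mul δ hidM x y


variable {δ} in
/-- **The adelic relabelling under `γ ∈ K_δ(1)`**: for a torsion label `x ∈ (ℤ/M)^{2g}` and its image `γ̄_M x`, the
rational representatives `x/M` and `(γ̄_M x)/M` satisfy `γ·(x/M) ≡ (γ̄_M x)/M (mod ẑ^{2g})` — entrywise
`γ x̃ − (γ̄_M x)~ ∈ M ẑ` since both reduce to `γ̄_M x` mod `M`. [cite: Milne2005ShimuraVarieties, §6 p. 75] -/
theorem adelicCongr_val_div_of_entries_residue {γk : gspFinAdelic δ} (hγ : γk ∈ principalLevelSubgroup δ 1)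
    {M : ℕ} [NeZero M] (ΓM : Matrix (Fin g ⊕ Fin g) (Fin g ⊕ Fin g) (ZMod M))
    (hΓM : ∀ (i j : Fin g ⊕ Fin g)
      (h : ((γk : GL (Fin g ⊕ Fin g) finAdeleQ) : Matrix (Fin g ⊕ Fin g) (Fin g ⊕ Fin g) finAdeleQ) i j ∈
        FiniteAdeleRing.integralAdeles (𝓞 ℚ) ℚ), ΓM i j = integralAdeleResidue M ⟨_, h⟩)
    (x : Fin g ⊕ Fin g → ZMod M) :
    AdelicCongr (γk : GL (Fin g ⊕ Fin g) finAdeleQ) 1 (fun i => ((x i).val : ℚ) / M)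
      (fun i => (((ΓM *ᵥ x) i).val : ℚ) / M) := by
  have hint : ∀ i j, ((γk : GL (Fin g ⊕ Fin g) finAdeleQ) : Matrix (Fin g ⊕ Fin g) (Fin g ⊕ Fin g) finAdeleQ) i j ∈
      FiniteAdeleRing.integralAdeles (𝓞 ℚ) ℚ := fun i j =>
    isIntegral_of_isCongOne_one (A := ((γk : GL (Fin g ⊕ Fin g) finAdeleQ) :
      Matrix (Fin g ⊕ Fin g) (Fin g ⊕ Fin g) finAdeleQ)) ((mem_principalLevelSubgroup_iff δ).1 hγ).1 i j
  set R := FiniteAdeleRing.integralAdeles (𝓞 ℚ) ℚ with hR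
  have hMQ : (M : ℚ) ≠ 0 := by exact_mod_cast NeZero.ne M
  intro i
  rw [Units.val_one, Matrix.one_mulVec, Pi.sub_apply]
  -- the integral element `y := (γ x̃ − (Γ_M x)~)_i` reduces to `0` mod `M`
  let xint : Fin g ⊕ Fin g → R := fun j => ⟨((x j).val : finAdeleQ), natCast_mem R _⟩
  let gint : R := ⟨(((ΓM *ᵥ x) i).val : finAdeleQ), natCast_mem R _⟩
  let yint : R := ∑ j, (⟨_, hint i j⟩ : R) * xint j - gint
  have hres : integralAdeleResidue M yint = 0 := by
    have h1 : ∀ j, integralAdeleResidue M (xint j) = x j := fun j => by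
      show integralAdeleResidue M ⟨((x j).val : finAdeleQ), _⟩ = x j
      rw [integralAdeleResidue_natCast, ZMod.natCast_zmod_val]
    have h2 : integralAdeleResidue M gint = (ΓM *ᵥ x) i := by
      show integralAdeleResidue M ⟨(((ΓM *ᵥ x) i).val : finAdeleQ), _⟩ = _
      rw [integralAdeleResidue_natCast, ZMod.natCast_zmod_val]
    have h3 : ∀ j, integralAdeleResidue M (⟨_, hint i j⟩ : R) = ΓM i j := fun j => (hΓM i j (hint i j)).symm
    simp only [yint, map_sub, map_sum, map_mul, h1, h2, h3]
    rw [Matrix.mulVec, dotProduct, sub_self]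
  -- hence `y ∈ M ẑ`: `y = M z` with `z` integral
  obtain ⟨z, hz, hzy⟩ := mem_levelIdeal_iff.1 ((integralAdeleResidue_eq_zero_iff M yint).1 hres)
  -- the coordinate `(γ (x̃/M) − (Γ_M x)~/M)_i = (1/M) · y = z`
  set c : finAdeleQ := algebraMap ℚ finAdeleQ ((1 : ℚ) / M) with hc
  have hcM : c * (M : finAdeleQ) = 1 := by
    rw [hc, ← map_natCast (algebraMap ℚ finAdeleQ) M, ← map_mul, one_div_mul_cancel hMQ, map_one]
  have hq : ∀ n : ℕ, algebraMap ℚ finAdeleQ ((n : ℚ) / M) = c * n := fun n => by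
    rw [div_eq_mul_one_div, map_mul, map_natCast, hc, mul_comm]
  have hcoord : (((γk : GL (Fin g ⊕ Fin g) finAdeleQ) : Matrix (Fin g ⊕ Fin g) (Fin g ⊕ Fin g) finAdeleQ) *ᵥ
        adelicVec (fun i => ((x i).val : ℚ) / M)) i -
        adelicVec (fun i => (((ΓM *ᵥ x) i).val : ℚ) / M) i = c * (yint : finAdeleQ) := by
    simp only [Matrix.mulVec, dotProduct, adelicVec_eq_comp, Function.comp_apply, hq, yint, xint, gint,
      AddSubgroupClass.coe_sub, AddSubmonoidClass.coe_finsetSum, MulMemClass.coe_mul]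
    rw [mul_sub, Finset.mul_sum]
    refine congrArg₂ _ (Finset.sum_congr rfl fun j _ => ?_) rfl
    ring
  rw [hcoord, ← hzy, ← mul_assoc, hcM, one_mul]
  exact hz

end Literature.AlgebraicGeometry.ModuliOfAbelianVarieties
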